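import Mathlib.RingTheory.DedekindDomain.Different
import Mathlib.NumberTheory.NumberField.CanonicalEmbedding.Basic
import Mathlib.LinearAlgebra.BilinearForm.Properties
import Mathlib.Algebra.Order.Archimedean.Basic
import Literature.NumberTheory.Automorphic.AdelicAdditiveCharacter
import HarnessLib

/-!
# `K^⊥ = K`: the twists of the standard character separate the points of `𝔸_K ⧸ K`; conductors

Trunk `AutomorphicAxiomatic` (G19), topic `NumberTheory/Automorphic`; namespace `Literature.Automorphic`.
Sequel to `AdelicAdditiveCharacter` (Tate's standard character `ψ_K = adeleAddChar K` of `𝔸_K`,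
trivial on `K`). We prove the two remaining inputs of the global Fourier analysis of automorphic
forms (Whittaker coefficients):

* **Tate's Theorem 4.1.4, `K^⊥ = K`** (`exists_eq_algebraMap_of_forall_adeleAddChar_mul_eq_one`,
  `forall_adeleAddChar_mul_eq_one_iff`, `exists_sub_eq_algebraMap_of_forall_adeleAddChar_mul_eq`):
  an adele `x` with `ψ_K(ξ x) = 1` for all `ξ ∈ K` lies in `K`; equivalently the characters
  `ψ_ξ = ψ_K(ξ ·)`, `ξ ∈ K`, of the compact group `𝔸_K ⧸ K` separate points (with Stone–Weierstrass:
  they span a dense subalgebra of `C(𝔸_K ⧸ K)`, so a continuous function all of whose Fourier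
  coefficients vanish is zero — the non-vanishing of Whittaker coefficients of cusp forms).
* **Conductors** (`finite_setOf_adeleAddCharAt_eq_one`, `eventually_exists_adeleAddCharAt_ne_one`;
  Tate's Lemma 2.2.3 in qualitative form): `ψ_v(𝒪_v) = 1` for every `v` (previous file) and, for
  all but finitely many `v`, `ψ_v` is *not* trivial on `𝔭_v⁻¹` — the normalisation used in every
  unramified computation (e.g. the vanishing of spherical Whittaker functions off the dominant
  cone).

## Proofs

Tate deduces Thm. 4.1.4 from the compactness of `𝔸_K ⧸ K` and Pontryagin duality (`K^⊥` is a
discrete `K`-vector space containing `K` with finite index). We argue directly, in three steps: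
(1) reduce to `x ∈ K_∞ × ∏_v 𝒪_v` (`𝔸_K = K + (K_∞ × ∏ 𝒪_v)`); (2) **archimedean step**
(`exists_fst_eq_algebraMap`): `ψ_K(ξ x) = 1` for `ξ ∈ 𝓞 K` says `Tr_{K_∞/ℝ}(ξ x_∞) ∈ ℤ`, i.e. `x_∞`
lies in the dual lattice of `𝓞 K ⊆ K_∞ ≅ ℝ^{r₁} × ℂ^{r₂}` for the trace pairing `mixedTrace`,
`tracePairing` (non-degenerate, `tracePairing_nondegenerate`), which is the image of the codifferent
and in particular of `K` (`exists_eq_mixedEmbedding_of_forall_tracePairing_eq_int`, via Mathlib's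
`latticeBasis`, `BilinForm.dualBasis` and `Algebra.traceForm`); (3) **finite step**
(`eq_zero_of_fst_eq_zero`): if `x_∞ = 0`, the principal adeles `k` approximating the `ξ x` modulo
`∏ 𝒪_v` have integral traces together with all their `𝓞 K`-multiples, so lie in the codifferent
`𝔡⁻¹ = (𝓞 K)^∨` (Mathlib `FractionalIdeal.dual ℤ ℚ 1`), a fractional ideal with a common denominator
`D` (`exists_denominator_codifferent`); this bounds `|ξ x_v|_v` uniformly in `ξ ∈ K`, which forces
`x_v = 0` (`K` has elements of arbitrarily large `v`-adic absolute value; `MulArchimedean ℤᵐ⁰`).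
The conductor statement: if `ψ_v(𝔭_v⁻¹) = 1` then every `k ∈ K` of `v`-order `-1` integral
elsewhere lies in `𝔡⁻¹`, so `|k|_v ≤ |D|_v⁻¹`, whence `v ∣ D`.

## References

* J. Tate, *Fourier analysis in number fields and Hecke's zeta-functions*, in Cassels–Fröhlich
  (eds.), *Algebraic Number Theory* (1967), Ch. XV: Lemma 2.2.3 (PDF p. 336 of the held copy
  `book:editornd-algebraic-number-theory`), Lemma 4.1.3, Lemma 4.1.5, Thm. 4.1.4 (PDF pp. 357–359).
  [CasselsFrohlichANT1967]
* A. Deitmar, S. Echterhoff, *Principles of Harmonic Analysis* (2014), Thm. 13.3.7 (the case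
  `K = ℚ`, PDF pp. 330–331 of the held copy).
-/

noncomputable section

open NumberField IsDedekindDomain InfinitePlace nonZeroDivisors mixedEmbedding

namespace Literature.NumberTheory.Automorphic



section MixedTrace

open scoped Classical

variable (K : Type*) [Field K] [NumberField K]

/-- The trace form `ℝ^{r₁} × ℂ^{r₂} → ℝ` of the étale `ℝ`-algebra `K ⊗_ℚ ℝ` in Mathlib's mixed-space
coordinates: `x ↦ Σ_{w real} x_w + Σ_{w complex} 2 Re(x_w)`. [folklore] -/
def mixedTrace : mixedSpace K →ₗ[ℝ] ℝ where
  toFun x := (∑ w, x.1 w) + ∑ w, 2 * (x.2 w).re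
  map_add' x y := by
    simp only [Prod.fst_add, Pi.add_apply, Finset.sum_add_distrib, Prod.snd_add, Complex.add_re,
      mul_add]
    ring
  map_smul' c x := by
    simp only [Prod.smul_fst, Pi.smul_apply, smul_eq_mul, Prod.smul_snd,
      Complex.real_smul, Complex.mul_re, Complex.ofReal_re, Complex.ofReal_im, zero_mul,
      sub_zero, RingHom.id_apply, mul_add, Finset.mul_sum]
    congr 1
    exact Finset.sum_congr rfl fun w _ => by ring

/-- Unfolding of `mixedTrace`. [folklore] -/
theorem mixedTrace_apply (x : mixedSpace K) :
    mixedTrace K x = (∑ w, x.1 w) + ∑ w, 2 * (x.2 w).re := rfl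

/-- `Σ_w mult(w) · Re(σ_w k) = Tr_{K/ℚ}(k)`: the field trace as a sum over infinite places (the two
conjugate embeddings over a complex place have the same real part; Mathlib
`trace_eq_sum_embeddings`). [folklore] -/
theorem sum_mult_mul_re_embedding (k : K) :
    ∑ w : InfinitePlace K, (mult w : ℝ) * (w.embedding k).re = Algebra.trace ℚ K k := by
  have h1 : ∀ w : InfinitePlace K, (mult w : ℝ) * (w.embedding k).re =
      ∑ φ ∈ ({φ : K →+* ℂ | mk φ = w} : Finset _), (φ k).re := by
    intro w
    have hre : ∀ φ ∈ ({φ : K →+* ℂ | mk φ = w} : Finset _), (φ k).re = (w.embedding k).re := by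
      intro φ hφ
      have hφ' : mk φ = w := (Finset.mem_filter.1 hφ).2
      rcases embedding_mk_eq φ with h | h
      · rw [← hφ', h]
      · rw [← hφ', h, ComplexEmbedding.conjugate_coe_eq, Complex.conj_re]
    rw [Finset.sum_congr rfl hre, Finset.sum_const, card_filter_mk_eq, nsmul_eq_mul]
  rw [Finset.sum_congr rfl fun w _ => h1 w, Finset.sum_fiberwise Finset.univ mk fun φ => (φ k).re]
  have h2 : (algebraMap ℚ ℂ (Algebra.trace ℚ K k)) = ∑ σ : K →ₐ[ℚ] ℂ, σ k :=
    trace_eq_sum_embeddings ℂ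
  have h3 : (∑ φ : K →+* ℂ, (φ k).re) = (∑ σ : K →ₐ[ℚ] ℂ, σ k).re := by
    rw [Complex.re_sum]
    exact Fintype.sum_equiv RingHom.equivRatAlgHom _ _ fun φ => rfl
  rw [h3, ← h2, eq_ratCast, Complex.ratCast_re]

/-- On the image of `K` the mixed trace is the field trace: `Tr(ι(k)) = Tr_{K/ℚ}(k)`. [folklore] -/
theorem mixedTrace_mixedEmbedding (k : K) :
    mixedTrace K (mixedEmbedding K k) = Algebra.trace ℚ K k := by
  rw [mixedTrace_apply, ← sum_mult_mul_re_embedding]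
  have hre : ∀ w : {w : InfinitePlace K // IsReal w},
      (mixedEmbedding K k).1 w = (mult w.1 : ℝ) * (w.1.embedding k).re := by
    intro w
    rw [mixedEmbedding_apply_isReal, mult, if_pos w.2, Nat.cast_one, one_mul,
      ← embedding_of_isReal_apply w.2, Complex.ofReal_re]
  have hco : ∀ w : {w : InfinitePlace K // IsComplex w},
      2 * ((mixedEmbedding K k).2 w).re = (mult w.1 : ℝ) * (w.1.embedding k).re := by
    intro w
    rw [mixedEmbedding_apply_isComplex, mult, if_neg (not_isReal_iff_isComplex.2 w.2)]
    norm_num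
  simp_rw [hre, hco]
  rw [← Fintype.sum_subtype_add_sum_subtype (fun w : InfinitePlace K => IsReal w)
    (fun w => (mult w : ℝ) * (w.embedding k).re)]
  congr 1
  exact Fintype.sum_equiv (Equiv.subtypeEquivRight fun w => not_isReal_iff_isComplex.symm) _ _
    fun w => rfl

/-- The mixed trace of the image of an infinite adele is the trace form `Tr_{K_∞/ℝ}` of
`AdelicAdditiveCharacter` (compatibility of the two coordinate systems, Mathlib
`InfiniteAdeleRing.ringEquiv_mixedSpace_apply`). [folklore] -/
theorem mixedTrace_ringEquiv_mixedSpace (z : InfiniteAdeleRing K) :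
    mixedTrace K (InfiniteAdeleRing.ringEquiv_mixedSpace K z) = infiniteAdeleTrace K z := by
  rw [mixedTrace_apply, infiniteAdeleTrace_apply, InfiniteAdeleRing.ringEquiv_mixedSpace_apply]
  rw [← Fintype.sum_subtype_add_sum_subtype (fun w : InfinitePlace K => IsReal w)
    (fun w => (mult w : ℝ) * (Completion.extensionEmbedding w (z w)).re)]
  congr 1
  · refine Finset.sum_congr rfl fun w _ => ?_
    rw [mult, if_pos w.2, Nat.cast_one, one_mul, ← Completion.extensionEmbeddingOfIsReal_apply w.2,
      Complex.ofReal_re]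
  · refine Fintype.sum_equiv (Equiv.subtypeEquivRight fun w => not_isReal_iff_isComplex.symm) _ _
      fun w => ?_
    simp only [Equiv.subtypeEquivRight_apply_coe, mult, if_neg (not_isReal_iff_isComplex.2 w.2),
      Nat.cast_ofNat]
    rfl

/-- The **trace pairing** `⟨x, y⟩ = Tr(x y)` on the mixed space (the trace form of `K ⊗_ℚ ℝ`).
[folklore] -/
def tracePairing : LinearMap.BilinForm ℝ (mixedSpace K) :=
  LinearMap.mk₂ ℝ (fun x y => mixedTrace K (x * y))
    (fun x x' y => by rw [add_mul, map_add])
    (fun c x y => by rw [smul_mul_assoc, map_smul])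
    (fun x y y' => by rw [mul_add, map_add])
    (fun c x y => by rw [mul_smul_comm, map_smul])

/-- Unfolding of `tracePairing`. [folklore] -/
theorem tracePairing_apply (x y : mixedSpace K) : tracePairing K x y = mixedTrace K (x * y) := rfl

/-- The trace pairing is symmetric. [folklore] -/
theorem tracePairing_isSymm : (tracePairing K).IsSymm :=
  ⟨fun x y => by rw [tracePairing_apply, tracePairing_apply, mul_comm]⟩

/-- The trace pairing on the mixed space is non-degenerate. [folklore] -/
theorem tracePairing_nondegenerate : (tracePairing K).Nondegenerate := by
  refine (tracePairing_isSymm K).isRefl.nondegenerate_iff_separatingLeft.2 fun x hx => ?_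
  refine Prod.ext (funext fun w => ?_) (funext fun w => Complex.ext ?_ ?_)
  · have h := hx (Pi.single w 1, 0)
    rw [tracePairing_apply, mixedTrace_apply] at h
    simp only [Prod.fst_mul, Prod.snd_mul, mul_zero, Pi.zero_apply,
      Complex.zero_re, mul_zero, Finset.sum_const_zero, add_zero] at h
    rw [Finset.sum_eq_single w (fun w' _ hw' => by simp [Pi.single_eq_of_ne hw'])
      (fun hw => (hw (Finset.mem_univ w)).elim)] at h
    simpa using h
  · have h := hx (0, Pi.single w 1)
    rw [tracePairing_apply, mixedTrace_apply] at h
    simp only [Prod.fst_mul, mul_zero, Pi.zero_apply, Finset.sum_const_zero,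
      zero_add, Prod.snd_mul] at h
    rw [Finset.sum_eq_single w (fun w' _ hw' => by simp [Pi.single_eq_of_ne hw'])
      (fun hw => (hw (Finset.mem_univ w)).elim)] at h
    simpa using h
  · have h := hx (0, Pi.single w Complex.I)
    rw [tracePairing_apply, mixedTrace_apply] at h
    simp only [Prod.fst_mul, mul_zero, Pi.zero_apply, Finset.sum_const_zero,
      zero_add, Prod.snd_mul] at h
    rw [Finset.sum_eq_single w (fun w' _ hw' => by simp [Pi.single_eq_of_ne hw'])
      (fun hw => (hw (Finset.mem_univ w)).elim)] at h
    simpa using h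

/-- **Dual lattice of `𝓞 K` under the trace pairing lies in `K`.** If `y ∈ ℝ^{r₁} × ℂ^{r₂}` pairs
integrally with (the image of) an integral basis of `K`, then `y` is the image of an element of
`K` (namely of an element of the codifferent `𝔡⁻¹`, the `ℤ`-span of the trace-dual basis).
[folklore] -/
theorem exists_eq_mixedEmbedding_of_forall_tracePairing_eq_int (y : mixedSpace K)
    (h : ∀ i, ∃ n : ℤ, tracePairing K y (mixedEmbedding K (integralBasis K i)) = n) :
    ∃ c : K, y = mixedEmbedding K c := by
  classical
  set B := tracePairing K with hB_def
  have hB : B.Nondegenerate := tracePairing_nondegenerate K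
  set b := latticeBasis K with hb
  set d := B.dualBasis hB b with hd
  have htr : (Algebra.traceForm ℚ K).Nondegenerate := traceForm_nondegenerate ℚ K
  set d' := (Algebra.traceForm ℚ K).dualBasis htr (integralBasis K) with hd'
  -- the dual basis of the lattice basis is the image of the trace-dual basis of `K`
  have hdd' : ∀ i, d i = mixedEmbedding K (d' i) := by
    intro i
    apply d.repr.injective
    ext j
    rw [d.repr_self, LinearMap.BilinForm.dualBasis_repr_apply, hb, latticeBasis_apply,
      tracePairing_apply, ← map_mul, mixedTrace_mixedEmbedding]
    have := LinearMap.BilinForm.apply_dualBasis_left htr (integralBasis K) i j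
    rw [Algebra.traceForm_apply] at this
    rw [← hd'] at this
    rw [this, Finsupp.single_apply]
    split_ifs with hij hji hji
    · exact Rat.cast_one.symm
    · exact (hji hij.symm).elim
    · exact (hij hji.symm).elim
    · exact Rat.cast_zero.symm
  choose n hn using h
  refine ⟨∑ i, (n i : ℚ) • d' i, ?_⟩
  calc y = ∑ i, (d.repr y i) • d i := (d.sum_repr y).symm
    _ = ∑ i, (n i : ℝ) • mixedEmbedding K (d' i) := by
        refine Finset.sum_congr rfl fun i _ => ?_
        rw [LinearMap.BilinForm.dualBasis_repr_apply, hb, latticeBasis_apply, hn i, hdd' i]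
    _ = mixedEmbedding K (∑ i, (n i : ℚ) • d' i) := by
        rw [map_sum]
        refine Finset.sum_congr rfl fun i _ => ?_
        rw [Rat.smul_def, show ((n i : ℚ) : K) * d' i = (n i : ℤ) • d' i by
          rw [Rat.cast_intCast, zsmul_eq_mul], map_zsmul, Int.cast_smul_eq_zsmul]

end MixedTrace



section Separation

open scoped Classical

variable (K : Type*) [Field K] [NumberField K]

/-- Products of finite-integral adeles are finite-integral. [folklore] -/
theorem IsFiniteIntegral.mul {x y : AdeleRing (𝓞 K) K} (hx : IsFiniteIntegral K x)
    (hy : IsFiniteIntegral K y) : IsFiniteIntegral K (x * y) := fun v => by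
  change x.2 v * y.2 v ∈ _
  exact mul_mem (hx v) (hy v)

/-- Global integers are finite-integral adeles. [folklore] -/
theorem isFiniteIntegral_algebraMap_coe (r : 𝓞 K) :
    IsFiniteIntegral K (algebraMap K (AdeleRing (𝓞 K) K) (r : K)) :=
  (isFiniteIntegral_algebraMap_iff K (r : K)).2 ⟨r, rfl⟩

/-- `ψ_K(x) = 1` forces the archimedean trace of a finite-integral adele to be an integer.
[folklore] -/
theorem exists_int_eq_infiniteAdeleTrace_of_eq_one {x : AdeleRing (𝓞 K) K}
    (hx : IsFiniteIntegral K x) (h1 : adeleAddChar K x = 1) :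
    ∃ n : ℤ, (n : ℝ) = infiniteAdeleTrace K x.1 := by
  rw [adeleAddChar_apply_of_isFiniteIntegral K hx, ← AddCircle.toCircle_zero,
    (AddCircle.injective_toCircle one_ne_zero).eq_iff, neg_eq_zero, AddCircle.coe_eq_zero_iff] at h1
  obtain ⟨n, hn⟩ := h1
  exact ⟨n, by rw [← hn, zsmul_eq_mul, mul_one]⟩

/-- **Archimedean step.** If `x ∈ K_∞ × ∏_v 𝒪_v` and `ψ_K(ξ x) = 1` for every global integer `ξ`,
then `x_∞` is the image of an element of `K` (the trace-dual lattice of `𝓞 K` in `K_∞` lies in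
`K`, `exists_eq_mixedEmbedding_of_forall_tracePairing_eq_int`). [folklore] -/
theorem exists_fst_eq_algebraMap {x : AdeleRing (𝓞 K) K} (hx : IsFiniteIntegral K x)
    (h : ∀ ξ : 𝓞 K, adeleAddChar K (algebraMap K (AdeleRing (𝓞 K) K) (ξ : K) * x) = 1) :
    ∃ c : K, x.1 = algebraMap K (InfiniteAdeleRing K) c := by
  set e := InfiniteAdeleRing.ringEquiv_mixedSpace K with he
  have key : ∀ ξ : 𝓞 K, ∃ n : ℤ, tracePairing K (e x.1) (mixedEmbedding K (ξ : K)) = n := by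
    intro ξ
    obtain ⟨n, hn⟩ := exists_int_eq_infiniteAdeleTrace_of_eq_one K
      ((isFiniteIntegral_algebraMap_coe K ξ).mul K hx) (h ξ)
    refine ⟨n, ?_⟩
    rw [tracePairing_apply, InfiniteAdeleRing.mixedEmbedding_eq_algebraMap_comp, ← he, ← map_mul,
      mixedTrace_ringEquiv_mixedSpace, mul_comm]
    rw [hn]
    rfl
  obtain ⟨c, hc⟩ := exists_eq_mixedEmbedding_of_forall_tracePairing_eq_int K (e x.1) fun i => by
    simpa only [integralBasis_apply] using key (RingOfIntegers.basis K i)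
  refine ⟨c, e.injective ?_⟩
  rw [hc, InfiniteAdeleRing.mixedEmbedding_eq_algebraMap_comp]

/-- **A common denominator for the codifferent.** There is a non-zero global integer `D` such
that every `k ∈ K` all of whose multiples by global integers have integral trace (i.e. `k` in the
codifferent `𝔡⁻¹ = (𝓞 K)^∨`, Mathlib `FractionalIdeal.dual ℤ ℚ 1`) satisfies `D k ∈ 𝓞 K`.
[folklore] -/
theorem exists_denominator_codifferent : ∃ D : 𝓞 K, D ≠ 0 ∧ ∀ k : K,
    (∀ u : 𝓞 K, ∃ n : ℤ, (n : ℚ) = Algebra.trace ℚ K ((u : K) * k)) →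
      ∃ r : 𝓞 K, (r : K) = (D : K) * k := by
  obtain ⟨D, hD0, hD⟩ := (FractionalIdeal.dual ℤ ℚ (1 : FractionalIdeal (𝓞 K)⁰ K)).isFractional
  refine ⟨D, nonZeroDivisors.ne_zero hD0, fun k hk => ?_⟩
  have hkd : k ∈ FractionalIdeal.dual ℤ ℚ (1 : FractionalIdeal (𝓞 K)⁰ K) := by
    rw [FractionalIdeal.mem_dual (one_ne_zero' (FractionalIdeal (𝓞 K)⁰ K))]
    intro a ha
    rw [FractionalIdeal.mem_one_iff] at ha
    obtain ⟨u, rfl⟩ := ha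
    obtain ⟨n, hn⟩ := hk u
    refine ⟨n, ?_⟩
    rw [Algebra.traceForm_apply, mul_comm, ← hn, eq_intCast]
  obtain ⟨r, hr⟩ := hD k hkd
  refine ⟨r, ?_⟩
  rw [Algebra.smul_def] at hr
  exact hr

/-- **Finite step.** An adele with vanishing archimedean part on which all the twists `ψ_ξ`,
`ξ ∈ K`, are trivial is zero: the `k ∈ K` approximating the `ξ z` modulo `∏ 𝒪_v` have integral
traces and form an `𝓞 K`-module, hence lie in the codifferent, a fractional ideal; a common
denominator then bounds `|ξ z_v|_v` uniformly in `ξ ∈ K`, forcing `z_v = 0`. [folklore] -/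
theorem eq_zero_of_fst_eq_zero {z : AdeleRing (𝓞 K) K} (hz : z.1 = 0)
    (h : ∀ ξ : K, adeleAddChar K (algebraMap K (AdeleRing (𝓞 K) K) ξ * z) = 1) : z = 0 := by
  -- the approximants
  set J : Set K := {k | ∃ ξ : K,
    IsFiniteIntegral K (algebraMap K (AdeleRing (𝓞 K) K) ξ * z - algebraMap K _ k)} with hJ
  have hJtr : ∀ k ∈ J, ∃ n : ℤ, (n : ℚ) = Algebra.trace ℚ K k := by
    rintro k ⟨ξ, hξ⟩
    have h1 := h ξ
    have hsplit : algebraMap K (AdeleRing (𝓞 K) K) ξ * z =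
        algebraMap K (AdeleRing (𝓞 K) K) k + (algebraMap K (AdeleRing (𝓞 K) K) ξ * z -
          algebraMap K (AdeleRing (𝓞 K) K) k) := by abel
    rw [hsplit, AddChar.map_add_eq_mul, adeleAddChar_algebraMap, one_mul,
      adeleAddChar_apply_of_isFiniteIntegral K hξ, AdeleRing.fst_sub, AdeleRing.algebraMap_fst,
      show (algebraMap K (AdeleRing (𝓞 K) K) ξ * z).1 = 0 by
        change (algebraMap K (AdeleRing (𝓞 K) K) ξ).1 * z.1 = 0; rw [hz, mul_zero],
      zero_sub, map_neg, infiniteAdeleTrace_algebraMap, AddCircle.coe_neg, neg_neg,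
      ← AddCircle.toCircle_zero, (AddCircle.injective_toCircle one_ne_zero).eq_iff,
      AddCircle.coe_eq_zero_iff] at h1
    obtain ⟨n, hn⟩ := h1
    refine ⟨n, ?_⟩
    have : ((n : ℚ) : ℝ) = ((Algebra.trace ℚ K k : ℚ) : ℝ) := by
      rw [← hn, zsmul_eq_mul, mul_one, Rat.cast_intCast]
    exact_mod_cast this
  have hJmul : ∀ k ∈ J, ∀ u : 𝓞 K, (u : K) * k ∈ J := by
    rintro k ⟨ξ, hξ⟩ u
    refine ⟨(u : K) * ξ, ?_⟩
    have : algebraMap K (AdeleRing (𝓞 K) K) ((u : K) * ξ) * z -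
        algebraMap K (AdeleRing (𝓞 K) K) ((u : K) * k) =
        algebraMap K (AdeleRing (𝓞 K) K) (u : K) *
          (algebraMap K (AdeleRing (𝓞 K) K) ξ * z - algebraMap K (AdeleRing (𝓞 K) K) k) := by
      rw [map_mul, map_mul]; ring
    rw [this]
    exact (isFiniteIntegral_algebraMap_coe K u).mul K hξ
  -- `J` lies in the codifferent
  have hJdual : ∀ k ∈ J, k ∈ FractionalIdeal.dual ℤ ℚ (1 : FractionalIdeal (𝓞 K)⁰ K) := by
    intro k hk
    rw [FractionalIdeal.mem_dual (one_ne_zero' (FractionalIdeal (𝓞 K)⁰ K))]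
    intro a ha
    rw [FractionalIdeal.mem_one_iff] at ha
    obtain ⟨u, rfl⟩ := ha
    obtain ⟨n, hn⟩ := hJtr _ (hJmul k hk u)
    refine ⟨n, ?_⟩
    rw [Algebra.traceForm_apply, mul_comm, ← hn, eq_intCast]
  -- a common denominator
  obtain ⟨D, hD0, hD⟩ := (FractionalIdeal.dual ℤ ℚ (1 : FractionalIdeal (𝓞 K)⁰ K)).isFractional
  have hD0' : (D : 𝓞 K) ≠ 0 := nonZeroDivisors.ne_zero hD0
  -- it suffices to show that every finite component vanishes
  suffices hfin : z.2 = 0 from Prod.ext hz hfin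
  refine RestrictedProduct.ext (R := fun w : HeightOneSpectrum (𝓞 K) => w.adicCompletion K)
    (fun w => (w.adicCompletionIntegers K : Set (w.adicCompletion K))) (x := z.2) (y := 0)
    (fun v : HeightOneSpectrum (𝓞 K) => ?_)
  change z.2 v = 0
  by_contra hzv
  set V : Valuation (v.adicCompletion K) (WithZero (Multiplicative ℤ)) := Valued.v with hV
  have hval : ∀ k : K, V (k : v.adicCompletion K) = v.valuation K k := fun k =>
    HeightOneSpectrum.valuedAdicCompletion_eq_valuation' v k
  have hVD : V ((D : K) : v.adicCompletion K) ≠ 0 := by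
    rw [hval, Valuation.ne_zero_iff]
    exact_mod_cast hD0'
  -- the uniform bound on `|ξ|_v`
  set M : WithZero (Multiplicative ℤ) :=
    max 1 (V ((D : K) : v.adicCompletion K))⁻¹ * (V (z.2 v))⁻¹ with hM
  have hbound : ∀ ξ : K, V (ξ : v.adicCompletion K) ≤ M := by
    intro ξ
    obtain ⟨k, hk⟩ := exists_isFiniteIntegral_sub_algebraMap K
      (algebraMap K (AdeleRing (𝓞 K) K) ξ * z)
    have hkJ : k ∈ J := ⟨ξ, hk⟩
    -- (a) the approximation at `v`
    have ha : V ((ξ : v.adicCompletion K) * z.2 v - (k : v.adicCompletion K)) ≤ 1 := by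
      have := hk v
      exact (HeightOneSpectrum.mem_adicCompletionIntegers (𝓞 K) K v).1 this
    -- (b) `D k` is a global integer
    obtain ⟨r, hr⟩ := hD k (hJdual k hkJ)
    have hb : V ((k : K) : v.adicCompletion K) ≤ (V ((D : K) : v.adicCompletion K))⁻¹ := by
      have hDk : V (((D : K) * k : K) : v.adicCompletion K) ≤ 1 := by
        have : (D : K) * k = (r : K) := by
          rw [← Algebra.smul_def, ← hr]
        rw [this, hval]
        exact HeightOneSpectrum.valuation_le_one v r
      rw [HeightOneSpectrum.adicCompletion.coe_mul, map_mul] at hDk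
      calc V (k : v.adicCompletion K)
          = (V ((D : K) : v.adicCompletion K))⁻¹ *
              (V ((D : K) : v.adicCompletion K) * V (k : v.adicCompletion K)) := by
            rw [← mul_assoc, inv_mul_cancel₀ hVD, one_mul]
        _ ≤ (V ((D : K) : v.adicCompletion K))⁻¹ * 1 := mul_le_mul_right hDk _
        _ = (V ((D : K) : v.adicCompletion K))⁻¹ := mul_one _
    -- (c) ultrametric inequality
    have hc : V ((ξ : v.adicCompletion K) * z.2 v) ≤
        max 1 (V ((D : K) : v.adicCompletion K))⁻¹ := by
      have := V.map_add ((ξ : v.adicCompletion K) * z.2 v - (k : v.adicCompletion K))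
        (k : v.adicCompletion K)
      rw [sub_add_cancel] at this
      exact this.trans (max_le_max ha hb)
    rw [map_mul] at hc
    have hz0 : V (z.2 v) ≠ 0 := (Valuation.ne_zero_iff V).2 hzv
    calc V (ξ : v.adicCompletion K)
        = V (ξ : v.adicCompletion K) * V (z.2 v) * (V (z.2 v))⁻¹ := by
          rw [mul_assoc, mul_inv_cancel₀ hz0, mul_one]
      _ ≤ max 1 (V ((D : K) : v.adicCompletion K))⁻¹ * (V (z.2 v))⁻¹ :=
          mul_le_mul_left hc _
  -- an element of `K` of large `v`-adic absolute value
  obtain ⟨t, htv, ht0⟩ : ∃ t : 𝓞 K, t ∈ v.asIdeal ∧ t ≠ 0 :=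
    Submodule.exists_mem_ne_zero_of_ne_bot v.ne_bot
  have htlt : V ((t : K) : v.adicCompletion K) < 1 := by
    rw [hval, HeightOneSpectrum.valuation_of_algebraMap]
    exact (HeightOneSpectrum.intValuation_lt_one_iff_mem v t).2 htv
  have htne : V ((t : K) : v.adicCompletion K) ≠ 0 := by
    rw [hval, Valuation.ne_zero_iff]
    exact_mod_cast ht0
  set γ := (V ((t : K) : v.adicCompletion K))⁻¹ with hγ
  have hγ1 : 1 < γ := (one_lt_inv₀ (zero_lt_iff.2 htne)).2 htlt
  -- `M ≠ 0` (test `ξ = 1`) and the archimedean property give the contradiction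
  have hM1 : 1 ≤ M := by
    have := hbound 1
    rwa [hval, map_one] at this
  have hM0 : M ≠ 0 := ne_of_gt (lt_of_lt_of_le zero_lt_one hM1)
  obtain ⟨n, hn⟩ := MulArchimedean.arch (M * γ) hγ1
  have hpow : V ((((t : K)⁻¹ ^ n : K)) : v.adicCompletion K) = γ ^ n := by
    rw [hval, map_pow, map_inv₀, hγ, hval]
  have hle : M * γ ≤ M := hn.trans (hpow ▸ hbound ((t : K)⁻¹ ^ n))
  have : γ ≤ 1 := by
    calc γ = M⁻¹ * (M * γ) := by rw [← mul_assoc, inv_mul_cancel₀ hM0, one_mul]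
      _ ≤ M⁻¹ * M := mul_le_mul_right hle _
      _ = 1 := inv_mul_cancel₀ hM0
  exact absurd hγ1 (not_lt.2 this)

/-- Twisting the hypothesis `ψ_K(ξ x) = 1 ∀ ξ` by a principal adele. [folklore] -/
theorem forall_adeleAddChar_mul_sub_algebraMap {x : AdeleRing (𝓞 K) K}
    (h : ∀ ξ : K, adeleAddChar K (algebraMap K (AdeleRing (𝓞 K) K) ξ * x) = 1) (k : K) :
    ∀ ξ : K, adeleAddChar K (algebraMap K (AdeleRing (𝓞 K) K) ξ *
      (x - algebraMap K (AdeleRing (𝓞 K) K) k)) = 1 := by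
  intro ξ
  rw [mul_sub, ← map_mul, AddChar.map_sub_eq_div, h ξ, adeleAddChar_algebraMap, div_one]

/-- **Tate's Theorem 4.1.4, `K^⊥ = K`: the characters `ψ_ξ(x) = ψ_K(ξ x)`, `ξ ∈ K`, cut out
exactly `K` inside `𝔸_K`.** An adele `x` with `ψ_K(ξ x) = 1` for all `ξ ∈ K` is principal.
(Tate proves this from the compactness of `𝔸_K ⧸ K` and Pontryagin duality; the proof here is
direct: reduce to `x ∈ K_∞ × ∏ 𝒪_v`, identify `x_∞` through the trace-dual lattice
(`exists_fst_eq_algebraMap`), then kill the finite part with the codifferent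
(`eq_zero_of_fst_eq_zero`).) [cite: CasselsFrohlichANT1967, Ch. XV (Tate), Thm. 4.1.4] -/
theorem exists_eq_algebraMap_of_forall_adeleAddChar_mul_eq_one {x : AdeleRing (𝓞 K) K}
    (h : ∀ ξ : K, adeleAddChar K (algebraMap K (AdeleRing (𝓞 K) K) ξ * x) = 1) :
    ∃ k : K, x = algebraMap K (AdeleRing (𝓞 K) K) k := by
  -- reduce to a finite-integral adele
  obtain ⟨k₀, hk₀⟩ := exists_isFiniteIntegral_sub_algebraMap K x
  have h' := forall_adeleAddChar_mul_sub_algebraMap K h k₀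
  -- the archimedean component is principal
  obtain ⟨c, hc⟩ := exists_fst_eq_algebraMap K hk₀ fun ξ => h' ξ
  -- the rest vanishes
  have h'' := forall_adeleAddChar_mul_sub_algebraMap K h' c
  have hz1 :
      (x - algebraMap K (AdeleRing (𝓞 K) K) k₀ - algebraMap K (AdeleRing (𝓞 K) K) c).1 = 0 := by
    rw [AdeleRing.fst_sub, hc, AdeleRing.algebraMap_fst, sub_self]
  have hz := eq_zero_of_fst_eq_zero K hz1 h''
  refine ⟨k₀ + c, ?_⟩
  rw [map_add]
  rw [sub_sub, sub_eq_zero] at hz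
  exact hz

/-- `K^⊥ = K` as an equivalence. [cite: CasselsFrohlichANT1967, Ch. XV (Tate), Thm. 4.1.4] -/
theorem forall_adeleAddChar_mul_eq_one_iff (x : AdeleRing (𝓞 K) K) :
    (∀ ξ : K, adeleAddChar K (algebraMap K (AdeleRing (𝓞 K) K) ξ * x) = 1) ↔
      ∃ k : K, x = algebraMap K (AdeleRing (𝓞 K) K) k := by
  refine ⟨exists_eq_algebraMap_of_forall_adeleAddChar_mul_eq_one K, ?_⟩
  rintro ⟨k, rfl⟩ ξ
  rw [← map_mul, adeleAddChar_algebraMap]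

/-- **The characters `ψ_ξ`, `ξ ∈ K`, separate the points of `𝔸_K ⧸ K`**: two adeles with the same
values of all `ψ_ξ` differ by an element of `K`.
[cite: CasselsFrohlichANT1967, Ch. XV (Tate), Thm. 4.1.4] -/
theorem exists_sub_eq_algebraMap_of_forall_adeleAddChar_mul_eq {x y : AdeleRing (𝓞 K) K}
    (h : ∀ ξ : K, adeleAddChar K (algebraMap K (AdeleRing (𝓞 K) K) ξ * x) =
      adeleAddChar K (algebraMap K (AdeleRing (𝓞 K) K) ξ * y)) :
    ∃ k : K, x - y = algebraMap K (AdeleRing (𝓞 K) K) k := by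
  refine exists_eq_algebraMap_of_forall_adeleAddChar_mul_eq_one K fun ξ => ?_
  rw [mul_sub, AddChar.map_sub_eq_div, h ξ, div_self']

end Separation

section Conductor

open scoped Classical

variable (K : Type) [Field K] [NumberField K]

/-- **`ψ_v` is unramified of conductor exactly `𝒪_v` at almost all places**: the set of finite
places `v` at which the local component `ψ_v` is trivial on all of `𝔭_v⁻¹ = {|u|_v ≤ q_v}` is
finite (it consists of divisors of a denominator of the codifferent; Tate's Lemma 2.2.3 gives the
exact statement `conductor(ψ_v) = 𝔡_v⁻¹`).
[cite: CasselsFrohlichANT1967, Ch. XV (Tate), Lemma 2.2.3] -/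
theorem finite_setOf_adeleAddCharAt_eq_one :
    {v : HeightOneSpectrum (𝓞 K) | ∀ u : v.adicCompletion K,
      Valued.v u ≤ WithZero.exp (1 : ℤ) → adeleAddCharAt K v u = 1}.Finite := by
  obtain ⟨D, hD0, hD⟩ := exists_denominator_codifferent K
  -- the exceptional places divide `D`
  have hfin : {v : HeightOneSpectrum (𝓞 K) | v.asIdeal ∣ Ideal.span {D}}.Finite :=
    Ideal.finite_factors (by
      simpa only [ne_eq, Submodule.zero_eq_bot, Ideal.span_singleton_eq_bot] using hD0)
  refine hfin.subset fun v hv => ?_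
  simp only [Set.mem_setOf_eq] at hv ⊢
  rw [← HeightOneSpectrum.intValuation_lt_one_iff_dvd]
  by_contra hDv
  have hDv1 : v.intValuation D = 1 := le_antisymm (v.intValuation_le_one D) (not_lt.1 hDv)
  set V : Valuation (v.adicCompletion K) (WithZero (Multiplicative ℤ)) := Valued.v with hV
  have hval : ∀ k : K, V (k : v.adicCompletion K) = v.valuation K k := fun k =>
    HeightOneSpectrum.valuedAdicCompletion_eq_valuation' v k
  -- a global element of exact `v`-order `-1`, integral elsewhere
  obtain ⟨π, hπ⟩ := v.valuation_exists_uniformizer K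
  obtain ⟨k, hk⟩ := exists_isFiniteIntegral_sub_algebraMap K
    (adeleSingleHom K v ((π⁻¹ : K) : v.adicCompletion K))
  have hkw : ∀ w : HeightOneSpectrum (𝓞 K), w ≠ v →
      (k : w.adicCompletion K) ∈ w.adicCompletionIntegers K := by
    intro w hw
    have := hk w
    change (adeleSingleHom K v ((π⁻¹ : K) : v.adicCompletion K)).2 w -
      (algebraMap K (AdeleRing (𝓞 K) K) k).2 w ∈ _ at this
    rw [adeleSingleHom_apply_snd, finiteAdeleSingleHom_apply_of_ne K v _ hw, zero_sub,
      AdeleRing.algebraMap_snd] at this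
    simpa using neg_mem this
  have hkv : V (((π⁻¹ : K) : v.adicCompletion K) - (k : v.adicCompletion K)) ≤ 1 := by
    have := hk v
    change (adeleSingleHom K v ((π⁻¹ : K) : v.adicCompletion K)).2 v -
      (algebraMap K (AdeleRing (𝓞 K) K) k).2 v ∈ _ at this
    rw [adeleSingleHom_apply_snd, finiteAdeleSingleHom_apply_self, AdeleRing.algebraMap_snd] at this
    exact (HeightOneSpectrum.mem_adicCompletionIntegers (𝓞 K) K v).1 this
  have hπv : V ((π⁻¹ : K) : v.adicCompletion K) = WithZero.exp (1 : ℤ) := by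
    rw [hval, map_inv₀, hπ, ← WithZero.exp_neg, neg_neg]
  -- `|k|_v = q_v` exactly
  have hk_le : V (k : v.adicCompletion K) ≤ WithZero.exp (1 : ℤ) := by
    have := V.map_sub ((π⁻¹ : K) : v.adicCompletion K)
      (((π⁻¹ : K) : v.adicCompletion K) - (k : v.adicCompletion K))
    rw [sub_sub_cancel] at this
    refine this.trans (max_le hπv.le (hkv.trans ?_))
    rw [← WithZero.exp_zero]
    exact WithZero.exp_le_exp.2 zero_le_one
  have hk_ge : WithZero.exp (1 : ℤ) ≤ V (k : v.adicCompletion K) := by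
    by_contra hlt
    have := V.map_add (((π⁻¹ : K) : v.adicCompletion K) - (k : v.adicCompletion K))
      (k : v.adicCompletion K)
    rw [sub_add_cancel, hπv] at this
    have h1 : (1 : WithZero (Multiplicative ℤ)) < WithZero.exp (1 : ℤ) := by
      rw [← WithZero.exp_zero]; exact WithZero.exp_lt_exp.2 zero_lt_one
    exact absurd this (not_le.2 (max_lt (lt_of_le_of_lt hkv h1) (not_le.1 hlt)))
  -- all `𝓞 K`-multiples of `k` have integral trace
  have htr : ∀ u : 𝓞 K, ∃ n : ℤ, (n : ℚ) = Algebra.trace ℚ K ((u : K) * k) := by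
    intro u
    have h1 : adeleAddCharAt K v (((u : K) * k : K) : v.adicCompletion K) = 1 := by
      refine hv _ ?_
      rw [hval, map_mul, ← hval, ← hval]
      calc V ((u : K) : v.adicCompletion K) * V (k : v.adicCompletion K)
          ≤ 1 * WithZero.exp (1 : ℤ) := by
            refine mul_le_mul' ?_ hk_le
            rw [hval]; exact HeightOneSpectrum.valuation_le_one v u
        _ = WithZero.exp (1 : ℤ) := one_mul _
    rw [adeleAddCharAt_eq_of_sub_mem K v (k := (u : K) * k) (by simp)
      (fun w hw => by
        rw [HeightOneSpectrum.adicCompletion.coe_mul]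
        exact mul_mem (HeightOneSpectrum.coe_algebraMap_mem (𝓞 K) K w u) (hkw w hw)),
      ← AddCircle.toCircle_zero, (AddCircle.injective_toCircle one_ne_zero).eq_iff,
      AddCircle.coe_eq_zero_iff] at h1
    obtain ⟨n, hn⟩ := h1
    refine ⟨n, ?_⟩
    have : ((n : ℚ) : ℝ) = ((Algebra.trace ℚ K ((u : K) * k) : ℚ) : ℝ) := by
      rw [← hn, zsmul_eq_mul, mul_one, Rat.cast_intCast]
    exact_mod_cast this
  -- hence `D k` is integral, i.e. `|k|_v ≤ |D|_v⁻¹ = 1`: contradiction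
  obtain ⟨r, hr⟩ := hD k htr
  have hDk : V ((((D : K) * k) : K) : v.adicCompletion K) ≤ 1 := by
    rw [← hr, hval]; exact HeightOneSpectrum.valuation_le_one v r
  rw [HeightOneSpectrum.adicCompletion.coe_mul, map_mul, hval,
    HeightOneSpectrum.valuation_of_algebraMap, hDv1, one_mul] at hDk
  have h1 : (1 : WithZero (Multiplicative ℤ)) < WithZero.exp (1 : ℤ) := by
    rw [← WithZero.exp_zero]; exact WithZero.exp_lt_exp.2 zero_lt_one
  exact absurd (hk_ge.trans hDk) (not_le.2 h1)

/-- Hence **for all but finitely many `v` there is `u ∈ 𝔭_v⁻¹` with `ψ_v(u) ≠ 1`** (while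
`ψ_v(𝒪_v) = 1` always, `adeleAddCharAt_eq_one_of_mem`): `ψ_v` has conductor exactly `𝒪_v`.
[cite: CasselsFrohlichANT1967, Ch. XV (Tate), Lemma 2.2.3] -/
theorem eventually_exists_adeleAddCharAt_ne_one :
    ∀ᶠ v : HeightOneSpectrum (𝓞 K) in Filter.cofinite, ∃ u : v.adicCompletion K,
      Valued.v u ≤ WithZero.exp (1 : ℤ) ∧ adeleAddCharAt K v u ≠ 1 := by
  have := finite_setOf_adeleAddCharAt_eq_one K
  rw [Filter.eventually_cofinite]
  refine this.subset fun v hv => ?_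
  simp only [Set.mem_setOf_eq, not_exists, not_and, not_not] at hv ⊢
  exact hv

end Conductor

end Literature.NumberTheory.Automorphic
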